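import Literature.Geometry.Symplectic.OrigamiForm
import Literature.Topology.FourManifolds.SmoothOrientation
import HarnessLib

/-!
# Fold-forms for four-folds (Cannas da Silva 2010) — named fact

A. Cannas da Silva, *Fold-forms for four-folds*, J. Symplectic Geom. 8 (2010) 189–203 =
arXiv:0909.4067 [`Cannasdasilva2010`], read in the held copy `paper:arxiv-0909.4067`:

* §2 Definition 1 (chunk p. 5): "A folded symplectic form is a closed 2-form `ω` such that `ωⁿ`
  intersects the 0-section of `∧²ⁿ T*M` tranversally, and such that `ı*ω` has maximal rank
  everywhere, where `ı : Z ↪ M` is the inclusion of the zero-locus, `Z`, of `ωⁿ`. By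
  tranversality, `Z` is a codimension-1 submanifold of `M`, called the folding hypersurface."
  — for `n = 2` this is exactly the tree structure `Literature.Geometry.Symplectic.IsFoldedForm`
  (= Cannas da Silva–Guillemin–Pires 2010, Def. 2.1), with the hypersurface carried as data.
* §1 Theorem 2 (chunk p. 4; Theorem B of the journal version): "Let `M` be an orientable
  4-manifold. Then `M` admits a folded symplectic form consistent with any given stable almost
  complex structure and in any degree 2 cohomology class." (Special case of Theorem 1: a
  `2n`-manifold with a stable almost complex structure admits a folded symplectic form; every
  orientable 4-manifold has one since `W₃ = 0`, Hirzebruch–Hopf.)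
* §4, paragraph before Lemma 3 (chunk p. 7): starting from the empty hypersurface the folding
  hypersurface may be taken to be a union of small spheres, "as many as half of the absolute value
  of the difference of the Euler numbers of `TM` and of `i*H`".

The fact below vendors Theorem 2 in the WEAKER form that forgets the consistency with a stable
almost complex structure and the cohomology class (neither has a carrier in the tree), for COMPACT
`M` (so that the folding hypersurface is a compact embedded 3-manifold, as `IsFoldedForm` +
`CompactSpace N` render it). It grounds the route item
`Summit.SmoothPoincare4.SmoothPoincare4.Theses.SymplecticOrigami.FoldedSphereFoldExistence`
(`stmt-SmoothPoincare4-14076`), which is STRONGER than the printed theorem: there `M` is a homotopy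
4-sphere and the fold is required to be ONE chart 3-sphere (Theorem 2 + the sphere count of §4 /
Lemma 3 with `χ(TM) = 2`, `χ(i*H) = c₂ = 0` for the trivial stable almost complex structure); that
refinement lives in the proof of Theorem A, not in a printed statement, and is not vendored here.
-/

open scoped Manifold ContDiff

namespace Literature.Geometry.Symplectic

/-- **Cannas da Silva 2010, Theorem 2 (orientable 4-manifolds are folded symplectic), compact weak
form.** Every compact orientable smooth 4-manifold `M` (Hausdorff, second countable, modelled on
`ℝ⁴`, carrying a smooth orientation) admits a folded symplectic form: a 2-form `s` together with
a compact smooth 3-manifold `N` and a map `j : N → M` such that `IsFoldedForm s N j` (`s` smooth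
and closed, `j` a smooth embedding onto the fold, `s ∧ s` transverse to zero along the fold,
maximal rank on the fold — Def. 1 of the paper = CdGP Def. 2.1). Printed: "Let `M` be an
orientable 4-manifold. Then `M` admits a folded symplectic form consistent with any given stable
almost complex structure and in any degree 2 cohomology class." — the consistency and cohomology
clauses and the non-compact case are dropped. Grounds
`Summit.SmoothPoincare4.SmoothPoincare4.Theses.SymplecticOrigami.FoldedSphereFoldExistence`
(which is stronger: one chart-sphere fold on a homotopy 4-sphere).
[cite: Cannasdasilva2010, Thm 2 (§1; = Thm 1 for `2n = 4` via Hirzebruch–Hopf `W₃ = 0`), Def. 1 (§2)] -/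
def CannasDaSilva2010_foldedForm_of_orientable : Prop :=
  ∀ (M : Type) [TopologicalSpace M] [T2Space M] [SecondCountableTopology M] [CompactSpace M]
    [ChartedSpace (EuclideanSpace ℝ (Fin 4)) M] [IsManifold (𝓡 4) ∞ M],
    Nonempty (Literature.Topology.FourManifolds.SmoothOrientation (𝓡 4) M) →
    ∃ (s : Literature.Geometry.Kaehler.MForm (𝓡 4) M ℝ 2) (N : Type) (_ : TopologicalSpace N)
      (_ : ChartedSpace (EuclideanSpace ℝ (Fin 3)) N) (_ : IsManifold (𝓡 3) ∞ N)
      (_ : CompactSpace N) (j : N → M), IsFoldedForm s N j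

end Literature.Geometry.Symplectic
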